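import Summits.Ventures.CertifiedManyBodySolver.Observables.RungLeavesPairWindow
import HarnessLib

/-!
# Ventures/CertifiedManyBodySolver — Observables/RungLeavesTTPrime.lean

HONEST FRAMING: first certified bounds on pairing observables; not a superconductivity verdict; every number
certified (two lineages + referee) or labelled float. hubbard-obs cell (D-0042); hubbard-obs-p1 seat
(`prover-hubbard-obs-p1-g4-0`), lead ruling (bs) «WANTED-LOW: t′-generic `M3ObsPairWindowAt` /
`M3ObsODLROCeilingAt` leaf family (copy of RungLeavesPairWindow with the t′ parameter)». Zero compute; no
certificate; no `sorry`; no new NAMED leaf (the named leaves stay `M3ObsPairWindowAtRange_r21_tp0`,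
`M3ObsODLROCeiling_tp0`).

**The same two target shapes at `(U, n, t′) = (8, 7/8, t′)` for an arbitrary next-nearest-neighbour hopping
`t′`** (the A0 anchor `t′ = −1/4` of the V8-A0 packet and any later `t′` row), so that `t′ ≠ 0` claim nodes
have a typed consumer of the same shape as the `t′ = 0` ones:
* `M3ObsPairWindowAt tp r W` — `∃ lo hi : ℚ, lo ≤ hi ∧ hi − lo ≤ W ∧` for every torus limit `ω` of unit
  `(rectN (7/8) L, S^z = 0)`-sector ground states of `hubbardTorusTT' L 1 tp 8` along `Ls → ∞`,
  `lo ≤ P̄_d(r)(ω) ≤ hi` (`P̄_d` = RungLeaves `dWavePairClassMean`); `M3ObsPairWindowAt_zero_iff` — at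
  `tp = 0` it IS `M3ObsPairWindowAt_tp0 r W` (definitional); `_mono`, `_intro`, `_of_orbitRows` (two
  certified `D₄`-orbit cells on the two-point pair word at `(0, r)` and on its negation, cap
  `M3EnergyUpperRow tp hi`, `hi ≤ u` — the RungLeavesPairWindow proof verbatim with `0 ↦ tp`);
* `M3ObsODLROCeilingAt tp c` — the Bragg/ODLRO-weight ceiling shape of RungLeaves `M3ObsODLROCeilingAt_tp0`
  at hopping `tp`; `_zero_iff` (definitional), `_mono`, `_of_orbitRow` (one certified orbit cell on the
  negated pair box word, `PairBoxWordD4.m3_dWavePair_braggWeight_le_of_orbitLowerRow_neg`, already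
  `tp`-generic).
Every proof offered is CONDITIONAL ON THE CLAIM NODES when fed from them (cap / floor / edge nodes BY
NAME; obs-ref O-D(d5)). HONEST: a window or a ceiling neither proves nor refutes the summit.
References: D. J. Scalapino, Phys. Rep. 250 (1995) 329, §2 eq. (2.4) [Scalapino1995].
-/

noncomputable section

namespace Summit.Ventures.CertifiedManyBodySolver.Observables

open Matrix Literature.MathematicalPhysics.QuantumLattice Literature.Probability.LatticeModels
open Literature.MathematicalPhysics.QuantumLattice.HubbardWave0 ThermodynamicLimit
open Summit.Ventures.CertifiedManyBodySolver.Certificates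
open MeasureTheory Complex Filter Topology
open scoped BigOperators ComplexOrder

/-! ## The at-range pair window at hopping `t′` -/

/-- **A certified two-sided window of width `≤ W` on the `D₄`-class-mean pair correlator `P̄_d(r)`** over
the thermodynamic-limit class at `(8, 7/8, t′)`: `∃ lo hi : ℚ, lo ≤ hi ∧ hi − lo ≤ W ∧ ∀ ω of the class,
lo ≤ P̄_d(r)(ω) ≤ hi`. [cite: Scalapino1995, §2 eq. (2.4)] -/
def M3ObsPairWindowAt (tp : ℝ) (r : Site 2) (W : ℚ) : Prop :=
  ∃ lo hi : ℚ, lo ≤ hi ∧ hi - lo ≤ W ∧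
    ∀ (ω : InfVolFermionState 2) (Ls : ℕ → ℕ) (ψ : ∀ L, Fock (Orb (FermionTorus 2 L))),
      Tendsto Ls atTop atTop →
      (∀ j, IsGroundStateInSector (hubbardTorusTT' (Ls j) 1 tp 8) (rectN (7/8) (Ls j)) 0 (ψ (Ls j))) →
      (∀ j, star (ψ (Ls j)) ⬝ᵥ ψ (Ls j) = 1) → ω.IsTorusLimitOf ψ Ls →
      ((lo : ℚ) : ℝ) ≤ dWavePairClassMean ω r ∧ dWavePairClassMean ω r ≤ ((hi : ℚ) : ℝ)

/-- At `t′ = 0` the generic window IS `M3ObsPairWindowAt_tp0 r W` (definitional). -/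
theorem M3ObsPairWindowAt_zero_iff (r : Site 2) (W : ℚ) :
    M3ObsPairWindowAt 0 r W ↔ M3ObsPairWindowAt_tp0 r W :=
  Iff.rfl

/-- … hence the NAMED `t′ = 0` leaf from the generic window at `t′ = 0`, `r = (2,1)`, `W ≤ 1`. -/
theorem M3ObsPairWindowAtRange_r21_tp0_of_windowAt_zero {W : ℚ} (h : M3ObsPairWindowAt 0 ![2, 1] W)
    (hW : W ≤ 1) : M3ObsPairWindowAtRange_r21_tp0 :=
  M3ObsPairWindowAtRange_r21_tp0_of_windowAt ((M3ObsPairWindowAt_zero_iff _ W).1 h) hW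

/-- Monotone transport (a certified tighter width implies every wider target). -/
theorem M3ObsPairWindowAt_mono {tp : ℝ} {r : Site 2} {W W' : ℚ} (h : M3ObsPairWindowAt tp r W)
    (hW : W ≤ W') : M3ObsPairWindowAt tp r W' := by
  obtain ⟨lo, hi, hle, hw, hall⟩ := h
  exact ⟨lo, hi, hle, hw.trans hW, hall⟩

/-- Introduction from an explicit certified window `[lo, hi]` on the class mean (the shape of the node files'
`…_window_of` theorems). -/
theorem M3ObsPairWindowAt_intro {tp : ℝ} {r : Site 2} {lo hi W : ℚ} (hle : lo ≤ hi) (hW : hi - lo ≤ W)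
    (h : ∀ (ω : InfVolFermionState 2) (Ls : ℕ → ℕ) (ψ : ∀ L, Fock (Orb (FermionTorus 2 L))),
      Tendsto Ls atTop atTop →
      (∀ j, IsGroundStateInSector (hubbardTorusTT' (Ls j) 1 tp 8) (rectN (7/8) (Ls j)) 0 (ψ (Ls j))) →
      (∀ j, star (ψ (Ls j)) ⬝ᵥ ψ (Ls j) = 1) → ω.IsTorusLimitOf ψ Ls →
      ((lo : ℚ) : ℝ) ≤ dWavePairClassMean ω r ∧ dWavePairClassMean ω r ≤ ((hi : ℚ) : ℝ)) :
    M3ObsPairWindowAt tp r W :=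
  ⟨lo, hi, hle, hW, h⟩

/-- **Two certified `D₄`-orbit cells at `(0, r)` ⇒ the window (hopping `t′`)**: a `D₄`-orbit cell
(`S = univ`) with constant `q_lo` on the two-point pair word at `(0, r)` and one with constant `q_up` on its
NEGATION, at threshold `u ≥ hi` where `M3EnergyUpperRow tp hi` is the cap cell, give
`M3ObsPairWindowAt tp r W` for every `W ≥ (−q_up) − q_lo` (dictionary `m3CorrOrbitLowerRow_dWavePair_iff` /
`expect_d4Emb_dWavePairWord`, Observables/PairWordD4Orbit.lean). [cite: Scalapino1995, §2 eq. (2.4)] -/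
theorem M3ObsPairWindowAt_of_orbitRows {tp : ℝ} {r : Site 2} {u hi qlo qup W : ℚ}
    (hlo : M3CorrOrbitLowerRow tp u qlo Finset.univ
      (pairRegion (insert (0 : Site 2) unitSteps) 0 ∪ pairRegion (insert (0 : Site 2) unitSteps) r)
      (fermionEmbed (PolySite.incl Finset.subset_union_left)
          (localPairAt (insert (0 : Site 2) unitSteps) dWaveFormFactor 0)ᴴ *
        fermionEmbed (PolySite.incl Finset.subset_union_right)
          (localPairAt (insert (0 : Site 2) unitSteps) dWaveFormFactor r)))
    (hup : M3CorrOrbitLowerRow tp u qup Finset.univ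
      (pairRegion (insert (0 : Site 2) unitSteps) 0 ∪ pairRegion (insert (0 : Site 2) unitSteps) r)
      (-(fermionEmbed (PolySite.incl Finset.subset_union_left)
          (localPairAt (insert (0 : Site 2) unitSteps) dWaveFormFactor 0)ᴴ *
        fermionEmbed (PolySite.incl Finset.subset_union_right)
          (localPairAt (insert (0 : Site 2) unitSteps) dWaveFormFactor r))))
    (hE : M3EnergyUpperRow tp hi) (hhi : hi ≤ u) (hq : qlo ≤ -qup) (hW : -qup - qlo ≤ W) :
    M3ObsPairWindowAt tp r W := by
  refine ⟨qlo, -qup, hq, by linarith, fun ω Ls ψ h1 h2 h3 h4 => ?_⟩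
  have hu : energyDensityTT' 1 tp 8 (7 / 8) ≤ ((u : ℚ) : ℝ) :=
    (show energyDensityTT' 1 tp 8 (7 / 8) ≤ ((hi : ℚ) : ℝ) from hE).trans (by exact_mod_cast hhi)
  have hl := (m3CorrOrbitLowerRow_dWavePair_iff tp u qlo Finset.univ r).1 hlo ω Ls ψ h1 h2 h3 h4 hu
  have hu' := hup ω Ls ψ h1 h2 h3 h4 hu
  have hneg : ∀ γ : DihedralGroup 4,
      (ω.expect (d4ShiftSet γ 0 (pairRegion (insert (0 : Site 2) unitSteps) 0 ∪
          pairRegion (insert (0 : Site 2) unitSteps) r))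
        (fermionEmbed (PolySite.d4Emb γ 0 (pairRegion (insert (0 : Site 2) unitSteps) 0 ∪
            pairRegion (insert (0 : Site 2) unitSteps) r))
          (-(fermionEmbed (PolySite.incl Finset.subset_union_left)
              (localPairAt (insert (0 : Site 2) unitSteps) dWaveFormFactor 0)ᴴ *
            fermionEmbed (PolySite.incl Finset.subset_union_right)
              (localPairAt (insert (0 : Site 2) unitSteps) dWaveFormFactor r))))).re =
      -(ω.dWavePairCorr 0 (d4Vec γ r)).re := fun γ => by
    rw [map_neg, map_neg, Complex.neg_re, expect_d4Emb_dWavePairWord, add_zero, add_zero,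
      (d4Vec_eq_zero_iff γ 0).2 rfl]
  simp only [hneg, Finset.sum_neg_distrib, mul_neg] at hu'
  refine ⟨?_, ?_⟩
  · simpa [dWavePairClassMean] using hl
  · have : dWavePairClassMean ω r ≤ -((qup : ℚ) : ℝ) := by
      unfold dWavePairClassMean; linarith
    simpa using this

/-! ## The ODLRO / Bragg-weight ceiling at hopping `t′` -/

/-- **A certified ceiling `c` on the `d`-wave pair Bragg weight at `k = 0`** over the thermodynamic-limit
class at `(8, 7/8, t′)`: for every torus limit `ω` of the class and every finite spectral measure `μ` of
its pair correlator `r ↦ ω.dWavePairCorr 0 r`, `braggWeight μ {0} ≤ c` (the RungLeaves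
`M3ObsODLROCeilingAt_tp0` shape at hopping `t′`). [cite: Scalapino1995, §2 eq. (2.4)] -/
def M3ObsODLROCeilingAt (tp : ℝ) (c : ℚ) : Prop :=
  ∀ (ω : InfVolFermionState 2) (Ls : ℕ → ℕ) (ψ : ∀ L, Fock (Orb (FermionTorus 2 L))),
    Tendsto Ls atTop atTop →
    (∀ j, IsGroundStateInSector (hubbardTorusTT' (Ls j) 1 tp 8) (rectN (7/8) (Ls j)) 0 (ψ (Ls j))) →
    (∀ j, star (ψ (Ls j)) ⬝ᵥ ψ (Ls j) = 1) → ω.IsTorusLimitOf ψ Ls →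
    ∀ (μ : Measure (EuclideanSpace ℝ (Fin 2))) [IsFiniteMeasure μ],
      (∀ r : Site 2, ∫ ξ, exp ((∑ i, (r i : ℝ) * ξ i : ℝ) * I) ∂μ = ω.dWavePairCorr 0 r) →
      braggWeight μ ![(0 : Fin 2 → ℝ)] ≤ ((c : ℚ) : ℝ)

/-- At `t′ = 0` the generic ceiling IS `M3ObsODLROCeilingAt_tp0 c` (definitional). -/
theorem M3ObsODLROCeilingAt_zero_iff (c : ℚ) : M3ObsODLROCeilingAt 0 c ↔ M3ObsODLROCeilingAt_tp0 c :=
  Iff.rfl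

/-- … hence the NAMED `t′ = 0` leaf from the generic ceiling at `t′ = 0` with `c ≤ 1/2`. -/
theorem M3ObsODLROCeiling_tp0_of_ceilingAt_zero {c : ℚ} (h : M3ObsODLROCeilingAt 0 c) (hc : c ≤ 1 / 2) :
    M3ObsODLROCeiling_tp0 :=
  M3ObsODLROCeilingAt_tp0_mono ((M3ObsODLROCeilingAt_zero_iff c).1 h) hc

/-- Monotone transport. -/
theorem M3ObsODLROCeilingAt_mono {tp : ℝ} {c c' : ℚ} (h : M3ObsODLROCeilingAt tp c) (hcc : c ≤ c') :
    M3ObsODLROCeilingAt tp c' :=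
  fun ω Ls ψ h1 h2 h3 h4 μ _ hμ => (h ω Ls ψ h1 h2 h3 h4 μ hμ).trans (by exact_mod_cast hcc)

/-- **One certified `D₄`-orbit cell on the negated pair box word ⇒ the ceiling (hopping `t′`)**: a LOWER
orbit cell `q ≤ ·` on `−pairBoxWord … B` (box `B ≠ ∅`) at cap `u ≥ hi`, `M3EnergyUpperRow tp hi`, gives
`M3ObsODLROCeilingAt tp c` for every `c ≥ −q/|B|²` (`PairBoxWordD4.m3_dWavePair_braggWeight_le_of_orbitLowerRow_neg`).
[cite: Scalapino1995, §2 eq. (2.4)] -/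
theorem M3ObsODLROCeilingAt_of_orbitRow {tp : ℝ} {u hi q c : ℚ} {B : Finset (Site 2)} (hB : B.Nonempty)
    (h : M3CorrOrbitLowerRow tp u q Finset.univ (B.biUnion (pairRegion (insert (0 : Site 2) unitSteps)))
      (-pairBoxWord (insert (0 : Site 2) unitSteps) dWaveFormFactor B))
    (hE : M3EnergyUpperRow tp hi) (hhi : hi ≤ u) (hc : -((q : ℚ) : ℝ) / ((B.card : ℝ)) ^ 2 ≤ ((c : ℚ) : ℝ)) :
    M3ObsODLROCeilingAt tp c :=
  fun ω Ls ψ h1 h2 h3 h4 μ _ hμ =>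
    (m3_dWavePair_braggWeight_le_of_orbitLowerRow_neg (S := Finset.univ) Finset.univ_nonempty hB h hE hhi
      ω Ls ψ h1 h2 h3 h4 μ hμ).trans hc

end Summit.Ventures.CertifiedManyBodySolver.Observables

end
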